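import Mathlib

/-!
# E3 lean-draft (SPARSE-MONOMIAL, INTEGER-COEFFICIENT variant E3Z: all kernel arithmetic in ℤ — no ℚ normalisation in the kernel): kernel replay of an E3 matrix-Putinar certificate as ONE scalar polynomial identity (lane balaban-calc, engine E3)

DRAFT under `run/shared/lean/ttrl/balaban-calc/e3/lean-draft/` — NOT a tree file (handed to ttrl2).  Object: for the block operator
`H(x)` of B4 CMP 89 (1.3)–(1.6) (entries polynomial in the free-link quaternion coordinates `x`), the certificate JSON
`e3/certs/<name>.json` (schema v3/v4, verified by `bal_e3_verify.py`) is re-encoded by `bal_e3_lean_emit.py` as data and the claim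
becomes the polynomial identity in the variables `X = (x, v)` (`v` = a test vector of length `dim`):

  `vᵀ H(x) v − γ |v|²  =  Σ_k D_k · ℓ_k(x,v)²  +  Σ_t g_t(x) · Σ_k D'_{t,k} · ℓ'_{t,k}(v)²  +  Σ_t (|x_t|² − 1) · W_t(x,v)`      (★)

with `D_k, D'_{t,k} ≥ 0`, `ℓ, ℓ'` explicit polynomials with rational coefficients, `g_t` the small-field hypotheses and `W_t` free.
On `{|x_t|² = 1 ∀t, g_t ≥ 0 ∀t}` the right-hand side of (★) is `≥ 0`, i.e. `vᵀH(x)v ≥ γ|v|²` for every `v`: `λ_min(H(x)) ≥ γ`.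

KERNEL CHECK (`decide +kernel` on literal data; no `native_decide`, no axioms): `PolyCert.check c = true`, where `check` expands both sides
of (★) into sparse polynomials over ℚ, merge-sorts the residual LHS − RHS with coefficient accumulation (fuelled structural recursion) and tests
that every coefficient is 0, and tests `D ≥ 0`.  SOUNDNESS `PolyCert.check_sound` is PROVED below (no sorry):
`check c = true → ∀ X, (∀ t, sphere_t(X) = 0) → (∀ t, 0 ≤ g_t(X)) → 0 ≤ eval X (lhs c)`, and `eval X (lhs c) = eval X c.quadH − γ·eval X c.vSq`.
-/

set_option autoImplicit false
/-! TREE COPY (substrate cell E3 PILOT, typer ruling (μ3), journal l.19196): part 1∕3 = the DEFINITIONS (sparse polynomials, `PolyCert`, `GramCert`, executable checks) of the lane checker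
`run/shared/lean/ttrl/balaban-calc/e3/lean-draft/tree/E3PolyCertZ.lean` (split at namespace seams for the tree's 400-line rule; one-line docstrings
added by script to undocumented declarations; NO other edit — in particular no literal, definition body or proof is changed).  HONEST: a
certificate CHECKER; the mathematics it serves is certified computation on small blocks ([B4] (1.3)–(1.6) block forms) — NOT Prop. (1.8), NOT an
input of any NE row today, NOT infinite volume ∕ mass gap ∕ Clay. -/


namespace E3Z

/-- SPARSE monomial: list of (variable index, exponent) pairs; semantics = product (order-free), so no invariant is needed for soundness -/
abbrev Mono := List (ℕ × ℕ)
/-- E3Z checker (definitions): `Poly` (lane output, transcribed verbatim; see the module docstring). -/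
abbrev Poly := List (Mono × ℤ)

namespace Poly

/-- E3Z checker (definitions): `evalMono` (lane output, transcribed verbatim; see the module docstring). -/
noncomputable def evalMono (X : ℕ → ℝ) : Mono → ℝ
  | [] => 1
  | ve :: m => X ve.1 ^ ve.2 * evalMono X m
/-- E3Z checker (definitions): `eval` (lane output, transcribed verbatim; see the module docstring). -/
noncomputable def eval (X : ℕ → ℝ) : Poly → ℝ
  | [] => 0
  | mc :: p => (mc.2 : ℝ) * evalMono X mc.1 + eval X p

/-- fuelled merge of two variable-sorted sparse monomials (adds exponents of equal variables); with exhausted fuel it appends — still multiplicative -/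
def addMonoF : ℕ → Mono → Mono → Mono
  | 0, a, b => a ++ b
  | _ + 1, [], b => b
  | _ + 1, a, [] => a
  | f + 1, (v, e) :: a, (w, e') :: b =>
      if v < w then (v, e) :: addMonoF f a ((w, e') :: b)
      else if w < v then (w, e') :: addMonoF f ((v, e) :: a) b
      else (v, e + e') :: addMonoF f a b
/-- E3Z checker (definitions): `addMono` (lane output, transcribed verbatim; see the module docstring). -/
def addMono (a b : Mono) : Mono := addMonoF (a.length + b.length) a b
/-- E3Z checker (definitions): `add` (lane output, transcribed verbatim; see the module docstring). -/
def add (p q : Poly) : Poly := p ++ q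
/-- E3Z checker (definitions): `neg` (lane output, transcribed verbatim; see the module docstring). -/
def neg (p : Poly) : Poly := p.map (fun mc => (mc.1, -mc.2))
/-- E3Z checker (definitions): `smul` (lane output, transcribed verbatim; see the module docstring). -/
def smul (c : ℤ) (p : Poly) : Poly := p.map (fun mc => (mc.1, c * mc.2))
/-- E3Z checker (definitions): `mulMono` (lane output, transcribed verbatim; see the module docstring). -/
def mulMono (a : Mono × ℤ) (q : Poly) : Poly := q.map (fun b => (addMono a.1 b.1, a.2 * b.2))
/-- E3Z checker (definitions): `mul` (lane output, transcribed verbatim; see the module docstring). -/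
def mul : Poly → Poly → Poly
  | [], _ => []
  | a :: p, q => mulMono a q ++ mul p q
/-- E3Z checker (definitions): `sumList` (lane output, transcribed verbatim; see the module docstring). -/
def sumList : List Poly → Poly
  | [] => []
  | p :: l => p ++ sumList l
/-- p² with symmetric folding: (a + q)² = a² + 2a·q + q² (half the products of `mul p p`) -/
def sqF : Poly → Poly
  | [] => []
  | a :: q => (addMono a.1 a.1, a.2 * a.2) :: (mulMono (a.1, 2 * a.2) q ++ sqF q)

/-- strict lexicographic order on sparse monomials (pairs compared by variable, then exponent) -/
def monoLT : Mono → Mono → Bool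
  | [], [] => false
  | [], _ :: _ => true
  | _ :: _, [] => false
  | (v, e) :: as, (w, e') :: bs =>
      if v < w then true else if w < v then false else if e < e' then true else if e' < e then false else monoLT as bs
/-- merge fuel: a literal ≥ any list length we meet (kernel Nat literals make `f+1` matching O(1)) -/
def mergeFuel : ℕ := 1099511627776
/-- fuelled merge of two lists, ADDING coefficients of equal monomials (structural recursion on the fuel: kernel-reducible) -/
def mergeF : ℕ → Poly → Poly → Poly
  | 0, p, q => p ++ q
  | _ + 1, [], q => q
  | _ + 1, p, [] => p
  | f + 1, (a, ca) :: p, (b, cb) :: q =>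
      if monoLT a b then (a, ca) :: mergeF f p ((b, cb) :: q)
      else if monoLT b a then (b, cb) :: mergeF f ((a, ca) :: p) q
      else (a, ca + cb) :: mergeF f p q
/-- E3Z checker (definitions): `splitAlt` (lane output, transcribed verbatim; see the module docstring). -/
def splitAlt : Poly → Poly × Poly
  | [] => ([], [])
  | [a] => ([a], [])
  | a :: b :: r => ((a :: (splitAlt r).1), (b :: (splitAlt r).2))
/-- E3Z checker (definitions): `msortF` (lane output, transcribed verbatim; see the module docstring). -/
def msortF : ℕ → Poly → Poly
  | 0, p => p
  | _ + 1, [] => []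
  | _ + 1, [a] => [a]
  | f + 1, a :: b :: r => mergeF mergeFuel (msortF f (a :: (splitAlt r).1)) (msortF f (b :: (splitAlt r).2))
/-- 64 halving levels sort any list of length < 2^64; NO `List.length` of the (huge) residual is ever taken (kernel stack) -/
def msort (p : Poly) : Poly := msortF 64 p
/-- E3Z checker (definitions): `isZero` (lane output, transcribed verbatim; see the module docstring). -/
def isZero (p : Poly) : Bool := (msort p).all (fun mc => decide (mc.2 = 0))
/-- identity map that turns LITERAL numerals into computed ones (`+0`): merging literal-encoded data with kernel-computed polynomials
otherwise triggers «(kernel) excessive memory consumption» (diagnosed 2026-08-20 on the (2,3,1) main identity; q5/q8 vs q9 probes). -/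
def renorm (p : Poly) : Poly := p.map (fun mc => (mc.1.map (fun ve => (ve.1 + 0, ve.2 + 0)), mc.2 + 0))
/-- slice key of a monomial: (index of its first v-variable) − nx, capped at dim; dim also for «no v-variable» -/
def vkey (nx dim : ℕ) (m : Mono) : ℕ :=
  match m.find? (fun ve => decide (nx ≤ ve.1)) with
  | some ve => min (ve.1 - nx) dim
  | none => dim
/-- E3Z checker (definitions): `sliceOf` (lane output, transcribed verbatim; see the module docstring). -/
def sliceOf (nx dim k : ℕ) (p : Poly) : Poly := p.filter (fun mc => decide (vkey nx dim mc.1 = k))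

end Poly

/-- E3Z checker (definitions): `WSq` (lane output, transcribed verbatim; see the module docstring). -/
structure WSq where
  D : ℤ
  ell : Poly

/-- E3Z checker (definitions): `PolyCert` (lane output, transcribed verbatim; see the module docstring). -/
structure PolyCert where
  nx : ℕ
  dim : ℕ
  gamma : ℤ
  quadH : Poly
  sos : List WSq
  ineq : List (Poly × List WSq)
  eq : List (Poly × Poly)

/-- E3Z checker (definitions): `sqSum` (lane output, transcribed verbatim; see the module docstring). -/
def sqSum : List WSq → Poly
  | [] => []
  | w :: l => Poly.smul w.D (Poly.sqF w.ell) ++ sqSum l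
/-- E3Z checker (definitions): `ineqSum` (lane output, transcribed verbatim; see the module docstring). -/
def ineqSum : List (Poly × List WSq) → Poly
  | [] => []
  | gi :: l => Poly.mul gi.1 (sqSum gi.2) ++ ineqSum l
/-- E3Z checker (definitions): `eqSum` (lane output, transcribed verbatim; see the module docstring). -/
def eqSum : List (Poly × Poly) → Poly
  | [] => []
  | ew :: l => Poly.mul ew.1 ew.2 ++ eqSum l
/-- E3Z checker (definitions): `allD` (lane output, transcribed verbatim; see the module docstring). -/
def allD : List WSq → Bool
  | [] => true
  | w :: l => decide (0 ≤ w.D) && allD l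
/-- E3Z checker (definitions): `allDI` (lane output, transcribed verbatim; see the module docstring). -/
def allDI : List (Poly × List WSq) → Bool
  | [] => true
  | gi :: l => allD gi.2 && allDI l

namespace PolyCert
variable (c : PolyCert)
/-- E3Z checker (definitions): `vSq` (lane output, transcribed verbatim; see the module docstring). -/
def vSq : Poly := (List.range c.dim).map (fun i => ([(c.nx + i, 2)], (1 : ℤ)))
/-- E3Z checker (definitions): `lhs` (lane output, transcribed verbatim; see the module docstring). -/
def lhs : Poly := Poly.add c.quadH (Poly.smul (-c.gamma) c.vSq)
/-- E3Z checker (definitions): `rhs` (lane output, transcribed verbatim; see the module docstring). -/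
def rhs : Poly := Poly.add (sqSum c.sos) (Poly.add (ineqSum c.ineq) (eqSum c.eq))
/-- E3Z checker (definitions): `nonnegD` (lane output, transcribed verbatim; see the module docstring). -/
def nonnegD : Bool := allD c.sos && allDI c.ineq
/-- E3Z checker (definitions): `check` (lane output, transcribed verbatim; see the module docstring). -/
def check : Bool := c.nonnegD && Poly.isZero (Poly.add c.lhs (Poly.neg c.rhs))
end PolyCert


/-! ## Gram-block input format, INTEGER version: per block, G = gnum/gden and L̃ = lnum/2^lden; the kernel checks the ℤ-identity
  4^lden · Σ_kl gnum_kl R_kR_l = Σ_k gden·(Σ_j lnum_jk R_j)² + Σ_i w_i R_i² + Σ_{i<j} |e_ij| (R_i ± R_j)²,   e := 4^lden·gnum − gden·lnum·lnumᵀ (integer),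
  w_i := e_ii − Σ_{j≠i}|e_ij|  — i.e. G·(gden·4^lden) = gden²·... written without any division; all weights are integers checked ≥ 0. -/

/-- E3Z checker (definitions): `GramBlock` (lane output, transcribed verbatim; see the module docstring). -/
structure GramBlock where
  rows : List (ℕ × ℕ)
  gden : ℕ
  gnum : List (List ℤ)
  lden : ℕ
  lnum : List (List ℤ)

/-- E3Z checker (definitions): `GramCert` (lane output, transcribed verbatim; see the module docstring). -/
structure GramCert where
  nx : ℕ
  dim : ℕ
  /-- global scale M > 0: quadH = M·vᵀH(x)v (integer coefficients), gamma = M·γ -/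
  M : ℕ
  gamma : ℤ
  quadH : Poly
  basis : List Mono
  /-- blocks with their integer factor fb = M / gden -/
  blocks : List (GramBlock × ℕ)
  /-- hypotheses: (integer-scaled hypothesis polynomial gZ = dg·g, block S, factor ft) with ft·dg·(1/gden_S)... — the emitter guarantees M-consistency; the kernel checks the identity -/
  ineq : List (Poly × GramBlock × ℕ)
  /-- sphere polynomials (integer) with integer multipliers WZ = M·W AND the emitter-expanded product E = sphere·WZ (checked per link by the kernel) -/
  eq : List (Poly × Poly × Poly)

namespace GramCert

/-- E3Z checker (definitions): `mget` (lane output, transcribed verbatim; see the module docstring). -/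
def mget (M_ : List (List ℤ)) (i j : ℕ) : ℤ := (M_.getD i []).getD j 0
/-- E3Z checker (definitions): `rowPoly` (lane output, transcribed verbatim; see the module docstring). -/
def rowPoly (nx : ℕ) (basis : List Mono) (r : ℕ × ℕ) : Poly := [(Poly.addMono (basis.getD r.1 []) [(nx + r.2, 1)], 1)]
/-- E3Z checker (definitions): `linComb` (lane output, transcribed verbatim; see the module docstring). -/
def linComb (nx : ℕ) (basis : List Mono) (rows : List (ℕ × ℕ)) (coef : ℕ → ℤ) : Poly :=
  ((List.range rows.length).filter (fun j => coef j ≠ 0)).flatMap (fun j => Poly.smul (coef j) (rowPoly nx basis (rows.getD j (0, 0))))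
/-- the explicit integer weighted squares of one block (see the section header) -/
def squares (nx : ℕ) (basis : List Mono) (b : GramBlock) : List WSq :=
  let n := b.rows.length
  let S : ℤ := ((4 : ℤ) ^ b.lden)
  let L : ℕ → ℕ → ℤ := fun i j => if j ≤ i then mget b.lnum i j else 0
  let e : ℕ → ℕ → ℤ := fun i j => S * mget b.gnum i j - (b.gden : ℤ) * ((List.range n).map (fun k => L i k * L j k)).sum
  let offAbs : ℕ → ℤ := fun i => ((List.range n).map (fun j => if j = i then 0 else |e i j|)).sum
  let chol : List WSq := (List.range n).map (fun k => ⟨(b.gden : ℤ), linComb nx basis b.rows (fun j => L j k)⟩)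
  let diag : List WSq := (List.range n).map (fun i => ⟨e i i - offAbs i, rowPoly nx basis (b.rows.getD i (0, 0))⟩)
  let off : List WSq := (List.range n).flatMap (fun i => ((List.range n).filter (fun j => i < j ∧ e i j ≠ 0)).map (fun j =>
      ⟨|e i j|, Poly.add (rowPoly nx basis (b.rows.getD i (0, 0))) (Poly.smul (if 0 ≤ e i j then 1 else -1) (rowPoly nx basis (b.rows.getD j (0, 0))))⟩))
  chol ++ diag ++ off
/-- Σ_kl gnum_kl R_k R_l (integer bilinear form of the block, one term per (k,l)) -/
def bilinear (nx : ℕ) (basis : List Mono) (b : GramBlock) : Poly :=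
  let n := b.rows.length
  (List.range n).flatMap (fun k => (List.range n).flatMap (fun l =>
    Poly.smul (mget b.gnum k l) (Poly.mul (rowPoly nx basis (b.rows.getD k (0, 0))) (rowPoly nx basis (b.rows.getD l (0, 0))))))
/-- one-block certificate: 4^lden · bilinear = explicit squares -/
def blockCert (nx : ℕ) (basis : List Mono) (b : GramBlock) : PolyCert where
  nx := nx
  dim := 0
  gamma := 0
  quadH := Poly.smul ((4 : ℤ) ^ b.lden) (bilinear nx basis b)
  sos := squares nx basis b
  ineq := []
  eq := []
/-- E3Z checker (definitions): `ineqBil` (lane output, transcribed verbatim; see the module docstring). -/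
def ineqBil (nx : ℕ) (basis : List Mono) : List (Poly × GramBlock × ℕ) → Poly
  | [] => []
  | gb :: l => Poly.smul (gb.2.2 : ℤ) (Poly.mul gb.1 (bilinear nx basis gb.2.1)) ++ ineqBil nx basis l
/-- E3Z checker (definitions): `blocksBil` (lane output, transcribed verbatim; see the module docstring). -/
def blocksBil (nx : ℕ) (basis : List Mono) : List (GramBlock × ℕ) → Poly
  | [] => []
  | b :: l => Poly.smul (b.2 : ℤ) (bilinear nx basis b.1) ++ blocksBil nx basis l
/-- literal data enter the main identity through `Poly.renorm` (see there) -/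
def ineqR (l : List (Poly × GramBlock × ℕ)) : List (Poly × GramBlock × ℕ) := l.map (fun t => (Poly.renorm t.1, t.2))
/-- Σ_t E_t (the pre-expanded sphere products, renormed literals) -/
def eqESum : List (Poly × Poly × Poly) → Poly
  | [] => []
  | t :: l => Poly.renorm t.2.2 ++ eqESum l
/-- per-link check: E_t IS sphere_t · W_t -/
def eqCheck (t : Poly × Poly × Poly) : Bool :=
  Poly.isZero (Poly.add (Poly.mul (Poly.renorm t.1) (Poly.renorm t.2.1)) (Poly.neg (Poly.renorm t.2.2)))
/-- E3Z checker (definitions): `mainResidual` (lane output, transcribed verbatim; see the module docstring). -/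
def mainResidual (gc : GramCert) : Poly :=
  Poly.add (Poly.add (Poly.renorm gc.quadH) (Poly.smul (-(gc.gamma + 0)) ((List.range gc.dim).map (fun i => ([(gc.nx + i, 2)], (1 : ℤ))))))
    (Poly.neg (Poly.add (blocksBil gc.nx gc.basis gc.blocks) (Poly.add (ineqBil gc.nx gc.basis (ineqR gc.ineq)) (eqESum gc.eq))))
/-- E3Z checker (definitions): `mainCheck` (lane output, transcribed verbatim; see the module docstring). -/
def mainCheck (gc : GramCert) : Bool := Poly.isZero (mainResidual gc)
/-- SLICED main check: slice k of the (unsorted) residual list, sorted and tested on its own (one kernel theorem per k = 0..dim) -/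
def mainSlice (gc : GramCert) (k : ℕ) : Bool := Poly.isZero (Poly.sliceOf gc.nx gc.dim k (mainResidual gc))

end GramCert

end E3Z
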